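import Summits.MatrixMultiplication.MatrixMultiplication.Theorems.ObstructionDescentUniversalOccurrenceTwoRectangleFourOddTableaux

set_option linter.dupNamespace false
set_option autoImplicit false

/-!
# Universal occurrence — two rectangles and the four-odd types `(2N-2j-3,2j+1,1,1)`: the domino sum, uniform in `j`
(decomp-mm · lens 3 · gen 44, K32-D)

Route `route-MatrixMultiplication-ObstructionDescent` (sub-problem `MatrixMultiplication`, `ω(ℂ) = 2`); SUPPORT for the crux
`NoOccurrenceObstruction` (`P_O`, item `stmt-MatrixMultiplication-29040`), universal-occurrence programme.  No `def`, no `sorry`,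
no enumeration.

The bookkeeping identity of the lifted design `D'_j(N)` (alphabet `[N+2]`, `φ = (0,…,N-1 | 0,1)`, `γ(n) = 1` for
`1 ≤ n ≤ j+1`, `γ(N) = 2`, `γ(N+1) = 3`, blocks `e = (q mod 2, q div 2)`), UNIFORM IN `j`: if the first-leg word `x = φ ∘ ι` is
a bijection on block `0` and the third-leg word `w = γ ∘ ι` vanishes on the arm (`q ≥ 4j+4`) and is `< 2` on the dominoes, then
`Σ_{i<2j} w(2i+4) + [2 ≤ ι(0) ≤ j+1] + [2 ≤ ι(2) ≤ j+1] + [{ι(0), ι(2)} ∩ {1, N+1} ≠ ∅] = j + 1`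
(`fourOdd_domino_sum`; `j = 2` is `oddFive_domino_sum`).  Proof: COUNT the slots of block `0` whose first-leg letter lies in
`{1,…,j+1}` — there are `j+1` of them since `x` is a bijection on the block (`Equiv.sum_comp` and a range sum) — and read the count
cell by cell: a domino top contributes `w`, the arm nothing, the column cells `0, 2` the three indicators (the two lifted ones
cannot both fire: `x(0) ≠ x(2)`).  The sum over the `2j` domino tops is re-indexed from the slots of block `0` by range sums.

[cite: BurgisserIkenmeyer2011, Thm. 4.4] [cite: BurgisserIkenmeyer2017, §5, Thm. 5.9 (proof of (2)), eq. (3.4)]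
-/

noncomputable section

open scoped BigOperators

namespace Summit.MatrixMultiplication.MatrixMultiplication.Theorems.ObstructionCalculus

open Literature.Computability.AlgebraicComplexity
open Literature.NumberTheory.DiophantineGeometry

/-- `#{v < M : 1 ≤ v ≤ j+1} = min M (j+2) - min M 1`. [folklore] -/
theorem sum_range_indicator_Icc_one (j : ℕ) : ∀ M : ℕ,
    (∑ v ∈ Finset.range M, (if 1 ≤ v ∧ v ≤ j + 1 then 1 else 0 : ℕ)) = min M (j + 2) - min M 1 := by
  intro M
  induction M with
  | zero => simp
  | succ M ih =>
    rw [Finset.sum_range_succ, ih]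
    split_ifs <;> omega

set_option maxHeartbeats 400000 in
/-- **Domino sum of block `0`, uniform in `j`.**  For a block-bijective first-leg word `x = φ ∘ ι` and a third-leg word
`w = γ ∘ ι` that vanishes on the arm and is `< 2` on the dominoes,
`Σ_{i<2j} w(2i+4) + [2 ≤ ι 0 ≤ j+1] + [2 ≤ ι 2 ≤ j+1] + [{ι 0, ι 2} ∩ {1, N+1} ≠ ∅] = j + 1`. [this node] -/
theorem fourOdd_domino_sum {N j : ℕ} (hN : 2 * j + 2 ≤ N) (e : Fin (N * 2) ≃ Fin 2 × Fin N)
    (hesymm : ∀ (a : Fin 2) (s : Fin N), ((e.symm (a, s) : Fin (N * 2)) : ℕ) = (a : ℕ) + 2 * (s : ℕ))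
    (ι : Fin (N * 2) → Fin (N + 2)) (x w : Word N (N * 2))
    (hxv : ∀ q, ((x q : Fin N) : ℕ) =
      if ((ι q : Fin (N + 2)) : ℕ) < N then ((ι q : Fin (N + 2)) : ℕ) else ((ι q : Fin (N + 2)) : ℕ) - N)
    (hwv : ∀ q, ((w q : Fin N) : ℕ) =
      if ((ι q : Fin (N + 2)) : ℕ) = 0 then 0 else if ((ι q : Fin (N + 2)) : ℕ) < j + 2 then 1
        else if ((ι q : Fin (N + 2)) : ℕ) = N then 2 else if ((ι q : Fin (N + 2)) : ℕ) = N + 1 then 3 else 0)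
    (hbx0 : Function.Bijective (fun s => x (e.symm (0, s))))
    (harm : ∀ q : Fin (N * 2), 4 * j + 4 ≤ (q : ℕ) → ((w q : Fin N) : ℕ) = 0)
    (hdom : ∀ q : Fin (N * 2), 4 ≤ (q : ℕ) → (q : ℕ) < 4 * j + 4 → ((w q : Fin N) : ℕ) < 2)
    {p0 p2 : Fin (N * 2)} (hp0 : (p0 : ℕ) = 0) (hp2 : (p2 : ℕ) = 2) :
    (∑ i : Fin (2 * j), ((w ⟨2 * (i : ℕ) + 4, by have := i.2; omega⟩ : Fin N) : ℕ)) +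
      ((if 2 ≤ ((ι p0 : Fin (N + 2)) : ℕ) ∧ ((ι p0 : Fin (N + 2)) : ℕ) < j + 2 then 1 else 0) +
        (if 2 ≤ ((ι p2 : Fin (N + 2)) : ℕ) ∧ ((ι p2 : Fin (N + 2)) : ℕ) < j + 2 then 1 else 0) +
        (if ((ι p0 : Fin (N + 2)) : ℕ) = 1 ∨ ((ι p2 : Fin (N + 2)) : ℕ) = 1 ∨ ((ι p0 : Fin (N + 2)) : ℕ) = N + 1 ∨
            ((ι p2 : Fin (N + 2)) : ℕ) = N + 1 then 1 else 0)) = j + 1 := by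
  classical
  -- the cells of block `0`
  obtain ⟨s0, hs0⟩ : ∃ s : Fin N, (s : ℕ) = 0 := ⟨⟨0, by omega⟩, rfl⟩
  obtain ⟨s1, hs1⟩ : ∃ s : Fin N, (s : ℕ) = 1 := ⟨⟨1, by omega⟩, rfl⟩
  have hc0 : e.symm (0, s0) = p0 := Fin.ext (by rw [hesymm, hs0, hp0]; simp)
  have hc1 : e.symm (0, s1) = p2 := Fin.ext (by rw [hesymm, hs1, hp2]; simp)
  have hcv : ∀ s : Fin N, ((e.symm (0, s) : Fin (N * 2)) : ℕ) = 2 * (s : ℕ) := fun s => by rw [hesymm]; simp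
  -- COUNT: `j+1` slots of block `0` carry a first-leg letter in `{1,…,j+1}`
  have hcount : (∑ s : Fin N, (if 1 ≤ ((x (e.symm (0, s)) : Fin N) : ℕ) ∧ ((x (e.symm (0, s)) : Fin N) : ℕ) ≤ j + 1
      then 1 else 0 : ℕ)) = j + 1 := by
    have h1 := Equiv.sum_comp (Equiv.ofBijective _ hbx0)
      (fun v : Fin N => (if 1 ≤ (v : ℕ) ∧ (v : ℕ) ≤ j + 1 then 1 else 0 : ℕ))
    simp only [Equiv.ofBijective_apply] at h1
    rw [h1, Fin.sum_univ_eq_sum_range (fun v : ℕ => (if 1 ≤ v ∧ v ≤ j + 1 then 1 else 0 : ℕ)) N,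
      sum_range_indicator_Icc_one j N]
    have h2 : min N (j + 2) = j + 2 := by omega
    have h3 : min N 1 = 1 := by omega
    rw [h2, h3]; omega
  -- READ the count cell by cell
  have hcell : ∀ s : Fin N,
      (if 1 ≤ ((x (e.symm (0, s)) : Fin N) : ℕ) ∧ ((x (e.symm (0, s)) : Fin N) : ℕ) ≤ j + 1 then 1 else 0 : ℕ) =
        (if 2 ≤ (s : ℕ) ∧ (s : ℕ) < 2 * j + 2 then ((w (e.symm (0, s)) : Fin N) : ℕ) else 0) +
        (if s = s0 then ((if 2 ≤ ((ι p0 : Fin (N + 2)) : ℕ) ∧ ((ι p0 : Fin (N + 2)) : ℕ) < j + 2 then 1 else 0) +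
          (if ((ι p0 : Fin (N + 2)) : ℕ) = 1 ∨ ((ι p0 : Fin (N + 2)) : ℕ) = N + 1 then 1 else 0) : ℕ) else 0) +
        (if s = s1 then ((if 2 ≤ ((ι p2 : Fin (N + 2)) : ℕ) ∧ ((ι p2 : Fin (N + 2)) : ℕ) < j + 2 then 1 else 0) +
          (if ((ι p2 : Fin (N + 2)) : ℕ) = 1 ∨ ((ι p2 : Fin (N + 2)) : ℕ) = N + 1 then 1 else 0) : ℕ) else 0) := by
    intro s
    have hx := hxv (e.symm (0, s))
    have hw := hwv (e.symm (0, s))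
    have hlt := (ι (e.symm (0, s))).2
    by_cases hs : s = s0
    · have hs' : ¬ s = s1 := fun h => by rw [h] at hs; have := congrArg Fin.val hs; omega
      rw [if_pos hs, if_neg hs', if_neg (show ¬ (2 ≤ (s : ℕ) ∧ (s : ℕ) < 2 * j + 2) by rw [hs, hs0]; omega), zero_add,
        add_zero]
      rw [hs, hc0] at hx
      rw [hs, hc0]
      split_ifs at hx ⊢ <;> omega
    by_cases hs' : s = s1
    · rw [if_neg hs, if_pos hs', if_neg (show ¬ (2 ≤ (s : ℕ) ∧ (s : ℕ) < 2 * j + 2) by rw [hs', hs1]; omega), zero_add,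
        zero_add]
      rw [hs', hc1] at hx
      rw [hs', hc1]
      split_ifs at hx ⊢ <;> omega
    rw [if_neg hs, if_neg hs', add_zero, add_zero]
    have h2 : 2 ≤ (s : ℕ) := by
      have h0 : (s : ℕ) ≠ 0 := fun h => hs (Fin.ext (by rw [h, hs0]))
      have h1 : (s : ℕ) ≠ 1 := fun h => hs' (Fin.ext (by rw [h, hs1]))
      omega
    by_cases hsj : (s : ℕ) < 2 * j + 2
    · rw [if_pos (show 2 ≤ (s : ℕ) ∧ (s : ℕ) < 2 * j + 2 from ⟨h2, hsj⟩)]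
      have hd := hdom (e.symm (0, s)) (by rw [hcv]; omega) (by rw [hcv]; omega)
      split_ifs at hx hw ⊢ <;> omega
    · rw [if_neg (show ¬ (2 ≤ (s : ℕ) ∧ (s : ℕ) < 2 * j + 2) from fun h => hsj h.2)]
      have ha := harm (e.symm (0, s)) (by rw [hcv]; omega)
      split_ifs at hx hw ⊢ <;> omega
  rw [Finset.sum_congr rfl (fun s _ => hcell s), Finset.sum_add_distrib, Finset.sum_add_distrib, Finset.sum_ite_eq',
    Finset.sum_ite_eq', if_pos (Finset.mem_univ _), if_pos (Finset.mem_univ _)] at hcount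
  -- the two lifted indicators cannot both fire: `x(0) ≠ x(2)`
  have hne : ((x p0 : Fin N) : ℕ) ≠ ((x p2 : Fin N) : ℕ) := by
    intro h
    have h' := hbx0.1 (show x (e.symm (0, s0)) = x (e.symm (0, s1)) by rw [hc0, hc1]; exact Fin.ext h)
    have := congrArg Fin.val h'; omega
  have hPQ : (if ((ι p0 : Fin (N + 2)) : ℕ) = 1 ∨ ((ι p0 : Fin (N + 2)) : ℕ) = N + 1 then 1 else 0 : ℕ) +
      (if ((ι p2 : Fin (N + 2)) : ℕ) = 1 ∨ ((ι p2 : Fin (N + 2)) : ℕ) = N + 1 then 1 else 0 : ℕ) =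
      (if ((ι p0 : Fin (N + 2)) : ℕ) = 1 ∨ ((ι p2 : Fin (N + 2)) : ℕ) = 1 ∨ ((ι p0 : Fin (N + 2)) : ℕ) = N + 1 ∨
          ((ι p2 : Fin (N + 2)) : ℕ) = N + 1 then 1 else 0) := by
    have hx0 := hxv p0
    have hx2 := hxv p2
    have hl0 := (ι p0).2
    have hl2 := (ι p2).2
    have hnb : ¬ ((((ι p0 : Fin (N + 2)) : ℕ) = 1 ∨ ((ι p0 : Fin (N + 2)) : ℕ) = N + 1) ∧
        (((ι p2 : Fin (N + 2)) : ℕ) = 1 ∨ ((ι p2 : Fin (N + 2)) : ℕ) = N + 1)) := by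
      intro h
      apply hne
      rw [hx0, hx2]
      split_ifs <;> omega
    split_ifs <;> omega
  -- RE-INDEX the domino tops from the slots of block `0`
  obtain ⟨F, hF⟩ : ∃ F : ℕ → ℕ, ∀ (n : ℕ) (h : n < N * 2), F n = ((w ⟨n, h⟩ : Fin N) : ℕ) :=
    ⟨fun n => if h : n < N * 2 then ((w ⟨n, h⟩ : Fin N) : ℕ) else 0, fun n h => dif_pos h⟩
  have hL : (∑ i : Fin (2 * j), ((w ⟨2 * (i : ℕ) + 4, by have := i.2; omega⟩ : Fin N) : ℕ)) =
      ∑ i ∈ Finset.range (2 * j), F (2 * i + 4) := by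
    rw [← Fin.sum_univ_eq_sum_range (fun i => F (2 * i + 4)) (2 * j)]
    exact Finset.sum_congr rfl (fun i _ => (hF _ _).symm)
  have hR : (∑ s : Fin N, (if 2 ≤ (s : ℕ) ∧ (s : ℕ) < 2 * j + 2 then ((w (e.symm (0, s)) : Fin N) : ℕ) else 0)) =
      ∑ s ∈ Finset.range N, (if 2 ≤ s ∧ s < 2 * j + 2 then F (2 * s) else 0) := by
    rw [← Fin.sum_univ_eq_sum_range (fun s => if 2 ≤ s ∧ s < 2 * j + 2 then F (2 * s) else 0) N]
    refine Finset.sum_congr rfl (fun s _ => ?_)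
    have hcs : e.symm (0, s) = ⟨2 * (s : ℕ), by omega⟩ := Fin.ext (by rw [hcv])
    rw [hcs, hF]
  obtain ⟨r, hr⟩ : ∃ r : ℕ, N = (2 + 2 * j) + r := ⟨N - 2 * j - 2, by omega⟩
  have hR' : (∑ s ∈ Finset.range N, (if 2 ≤ s ∧ s < 2 * j + 2 then F (2 * s) else 0)) =
      ∑ i ∈ Finset.range (2 * j), F (2 * i + 4) := by
    rw [hr, Finset.sum_range_add, Finset.sum_range_add]
    rw [Finset.sum_eq_zero (fun s hs => if_neg (fun h => by have := Finset.mem_range.1 hs; omega)), zero_add,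
      Finset.sum_eq_zero (fun s (hs : s ∈ Finset.range r) => if_neg (fun h => by omega)), add_zero]
    refine Finset.sum_congr rfl (fun i hi => ?_)
    have hi' := Finset.mem_range.1 hi
    rw [if_pos (by omega), show 2 * (2 + i) = 2 * i + 4 by ring]
  rw [hL, ← hR', ← hR]
  omega

end Summit.MatrixMultiplication.MatrixMultiplication.Theorems.ObstructionCalculus

end
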